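import Mathlib
import Literature.Analysis.FluidPDE.HardSphereCollisionRecord
import Literature.MathematicalPhysics.KineticTheory.HardSphereEuler
import Literature.MathematicalPhysics.KineticTheory.HardSphereEulerProofs
import Literature.MathematicalPhysics.KineticTheory.HardSphereUniformGas
import Summits.AtomisticToContinuum.HydrodynamicLimit.Theorems.OneFlightGossipEngineOneFlightLayeredChaosFluxRegimes
import Summits.AtomisticToContinuum.HydrodynamicLimit.Theorems.OneFlightGossipEngineOneFlightLayeredChaosPairMeasurable
import Summits.AtomisticToContinuum.HydrodynamicLimit.Theorems.OneFlightGossipEngineOneFlightLayeredChaosFirstFlightPairInput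
import HarnessLib

/-!
# `OneFlightGossipEngine.OneFlightLayeredChaos` — the velocity-fibre form of the first rung and its reduction
(crux stmt-AtomisticToContinuum-14535, line `Sketch`, serves the stub `stub_firstFlight_flux` — the `n = 0`, fresh-partner
rung — through the registered stub `regimeFluxBody_firstFlight_of_velInput`; stub worker of lead cycle c3, 2026-08-16). Part of the Lean-checked reduction
`FirstFlightVelInput θ₀ → FirstFlightPairInput θ₀ → FirstFlightInput θ₀ → RegimeFluxBody θ₀ ((shortGap θ₀ 0).inter nZero)`
split over the files `…FirstCollision`, `…FluxFunctional`, `…PairMeasurable`, `…FirstFlightInput`,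
`…FirstFlightPairInput`, `…FirstFlightVelInput` (grouping namespace `OLC`).

`FirstFlightVelInput θ₀` (typed hypothesis; the most reduced form): with the velocities of all particles FROZEN and the
positions distributed by `posGibbsMeasure 1 ε (N+1)`, on the first-flight event of the pair `(i, j)` the free-flight
contact normal is flux-distributed and independent of the `ℓ`-cells of all positions, up to `b(v)` with
`∫ b dγ ≤ Cσ^p/(N+1)`, `γ = ⊗ N(0, θ₀ I)`. `firstFlightPairInput_of_velInput`: by the rung-0 product structure
`P = (μ ⊗ γ) ∘ zipConfig⁻¹` (`localGibbsMeasure_rung0_eq_map`) and Fubini for both terms it implies `FirstFlightPairInput θ₀`;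
`regimeFluxBody_firstFlight_of_velInput` composes the whole chain.
-/

open scoped BigOperators ENNReal
open MeasureTheory Set
open Literature.Analysis.FluidPDE Literature.MathematicalPhysics.KineticTheory
open Summit.AtomisticToContinuum.HydrodynamicLimit.Theorems

namespace Summit.AtomisticToContinuum.HydrodynamicLimit.Theorems.OLC

noncomputable section

/-! ## The per-velocity input (positions Gibbs-random, velocities frozen) and its reduction to the pair input -/

/-- **First-flight VELOCITY-FIBRE input (the typed dynamical input of the first rung, disintegrated form).**
By the rung-0 product structure of the global Gibbs law (`localGibbsMeasure_rung0_eq_map`: positions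
`μ = posGibbsMeasure 1 ε (N+1)` — uniform on non-overlapping configurations —, velocities `γ = ⊗ N(0, θ₀ I)`,
independent), the first rung is a statement about POSITIONS ONLY, for each frozen velocity configuration `v`:
for `N ≥ N₀(σ, τ)`, every flow `Φ`, tagged `i`, candidate partner `j ≠ i`, there is a weight `b(v) ≥ defect` with
`∫ b dγ ≤ C σ^p/(N+1)` such that for every `v`, every measurable set of normals `U ⊆ ℝ³` and every measurable event
`T` of the `ℓ`-CELLS of all positions:
`|μ{x | z ∈ F ∧ ω(z) ∈ U ∧ cells(x) ∈ T} − Flux_{ĝ(v)}(U) · μ{x | z ∈ F ∧ cells(x) ∈ T}| ≤ b(v)`, `z = zipConfig (x, v)`,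
where `F` is the first-flight event of the pair (`i`'s first collision happens in the window, with `j`, `j` fresh),
`ω(z) = ε⁻¹ sepVec (freeFlight t₀ z i).1 (freeFlight t₀ z j).1` the contact normal of the two free flights and
`ĝ(v) = (v_i − v_j)/‖v_i − v_j‖`. In words: GIVEN THE EXACT VELOCITIES OF EVERYBODY, under the hard-core-uniform law
of the positions, on the first-flight event the contact normal of the pair is flux-distributed AND independent of the
coarse cells of all particles ("conditional Stosszahlansatz given coarse positions and exact velocities, `N`-uniform at
fixed reduced density"; Disproof.lean §8 N1). A typed HYPOTHESIS of the line (a named `Prop` the route posits; nothing is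
asserted, it is not a published fact); reduction: `regimeFluxBody_firstFlight_of_velInput`. -/
def FirstFlightVelInput (θ₀ : ℝ) : Prop :=
  ∃ C : ℝ, 0 < C ∧ ∃ p : ℝ, 0 < p ∧ ∃ σ₀ : ℝ, 0 < σ₀ ∧ ∀ σ : ℝ, 0 < σ → σ < σ₀ →
  ∀ τ : ℝ, 0 < τ → ∃ N₀ : ℕ, ∀ N : ℕ, N₀ ≤ N →
    ∀ Φ : HardSphereFlow (Torus.geometry (Fin 3)) (hsDiameter σ N) (N + 1),
    ∀ (i j : Fin (N + 1)), j ≠ i →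
    let G : Geometry (Fin 3) T3 := Torus.geometry (Fin 3)
    let ε : ℝ := hsDiameter σ N
    let w : ℝ := τ * ((N + 1 : ℕ) : ℝ) ^ (-(1 / 3 : ℝ))
    let q : T3 → (Fin 3 → ℤ) := Torus.coarseCell (rhoStar σ * ((N + 1 : ℕ) : ℝ) ^ (-(1 / 3 : ℝ)))
    let μ : Measure (Fin (N + 1) → T3) := posGibbsMeasure (fun _ => 1) ε (N + 1)
    let γ : Measure (Fin (N + 1) → V3) := Measure.pi fun _ => gaussMeasure (0 : V3) θ₀
    let t₀ : Config (N + 1) (Fin 3) T3 → ℝ := fun z => Φ.nthCollisionTimeOf i 0 z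
    let F : Set (Config (N + 1) (Fin 3) T3) := Φ.good ∩ {z | t₀ z ∈ Set.Ioc 0 w ∧ Φ.nthPartnerOf i 0 z = j ∧
        ∀ u ∈ Set.Ioo 0 (t₀ z), ¬ Participates G ε (Φ.flow u z) j}
    let ωPair : Config (N + 1) (Fin 3) T3 → V3 := fun z =>
      ε⁻¹ • G.sepVec (freeFlight G (t₀ z) z i).1 (freeFlight G (t₀ z) z j).1
    let flux : V3 → Set V3 → ℝ := fun g U =>
      ((∫⁻ ω, U.indicator (fun _ => (1 : ℝ≥0∞)) (ω : V3) * ENNReal.ofReal (max (-inner ℝ (ω : V3) g) 0)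
          ∂(sphereMeasure (E := V3))) /
        (∫⁻ ω, ENNReal.ofReal (max (-inner ℝ (ω : V3) g) 0) ∂(sphereMeasure (E := V3)))).toReal
    ∃ b : (Fin (N + 1) → V3) → ℝ, Integrable b γ ∧ ∫ v, b v ∂γ ≤ C * σ ^ p / (N + 1) ∧
      ∀ (v : Fin (N + 1) → V3) (U : Set V3), MeasurableSet U →
      ∀ T : Set (Fin (N + 1) → (Fin 3 → ℤ)), MeasurableSet T →
        |(μ {x | zipConfig (x, v) ∈ F ∧ ωPair (zipConfig (x, v)) ∈ U ∧ (fun k => q (x k)) ∈ T}).toReal -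
            flux (‖v i - v j‖⁻¹ • (v i - v j)) U *
              (μ {x | zipConfig (x, v) ∈ F ∧ (fun k => q (x k)) ∈ T}).toReal| ≤ b v

/-- **Disintegration over the velocities: the velocity-fibre input implies the pair input**
(`FirstFlightVelInput θ₀ → FirstFlightPairInput θ₀`). With `P = (μ ⊗ γ) ∘ zipConfig⁻¹` (`localGibbsLaw_eq`,
`localGibbsMeasure_rung0_eq_map`): `P(E) = ∫ μ(E_v) dγ(v)` for the measurable events
`E₁ = F ∩ {(ĝ, ω) ∈ S} ∩ D`, `E₂ = F ∩ D` (`Measure.prod_apply_symm`), and the compensator is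
`∫_{E₂} Flux_{ĝ}(S_ĝ) dP = ∫ Flux_{ĝ(v)}(S_{ĝ(v)}) μ((E₂)_v) dγ(v)` (Fubini, the integrand depends on `v` only); the
sections are the input's events with `U = S_{ĝ(v)}`, `T = T_v = {c | (c, v) ∈ T}`; so the defect is
`|∫ h dγ| ≤ ∫ |h| dγ ≤ ∫ b dγ ≤ Cσ^p/(N+1)`. [folklore] -/
theorem firstFlightPairInput_of_velInput {θ₀ : ℝ} (hθ : 0 < θ₀) (h : FirstFlightVelInput θ₀) :
    FirstFlightPairInput θ₀ := by
  obtain ⟨C, hC, p, hp, σ₀, hσ₀, H⟩ := h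
  refine ⟨C, hC, p, hp, min σ₀ 2⁻¹, lt_min hσ₀ (by norm_num), fun σ hσ hσlt => ?_⟩
  have hσ₀' : σ < σ₀ := hσlt.trans_le (min_le_left _ _)
  have hσ2 : σ ≤ 1 / 2 := by
    have := hσlt.trans_le (min_le_right _ _)
    rw [one_div]; exact this.le
  intro τ hτ
  obtain ⟨N₀, hN₀⟩ := H σ hσ hσ₀' τ hτ
  refine ⟨N₀, fun N hN Φ i j hji S hS T hT => ?_⟩
  intro G ε w q P t₀ F gPair ωPair flux D
  obtain ⟨b, hbi, hbint, hbv⟩ := hN₀ N hN Φ i j hji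
  -- the product structure of the global Gibbs law at rung 0
  set μ : Measure (Fin (N + 1) → T3) := posGibbsMeasure (fun _ : T3 => (1 : ℝ)) ε (N + 1) with hμdef
  set γ : Measure (Fin (N + 1) → V3) := Measure.pi fun _ : Fin (N + 1) => gaussMeasure (0 : V3) θ₀ with hγdef
  haveI : IsProbabilityMeasure μ := isProbabilityMeasure_posGibbsMeasure continuous_const (fun _ => one_pos) hσ2 N
  have hPeq : P = (μ.prod γ).map zipConfig := by
    show localGibbsLaw σ (fun _ => 1) (fun _ => 0) (fun _ => θ₀) N Φ = _
    rw [localGibbsLaw_eq, localGibbsMeasure_rung0_eq_map σ zero_le_one hθ (0 : V3) N]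
  -- velocity-dependent slices: the relative direction, the section of `S` and the section of `T`
  set gV : (Fin (N + 1) → V3) → V3 := fun v => ‖v i - v j‖⁻¹ • (v i - v j) with hgVdef
  have hgVm : Measurable gV :=
    (((measurable_pi_apply i).sub (measurable_pi_apply j)).norm.inv).smul
      ((measurable_pi_apply i).sub (measurable_pi_apply j))
  set Uv : (Fin (N + 1) → V3) → Set V3 := fun v => {ω | (gV v, ω) ∈ S} with hUvdef
  have hUv : ∀ v, MeasurableSet (Uv v) := fun v => (measurable_const.prodMk measurable_id) hS
  set Tv : (Fin (N + 1) → V3) → Set (Fin (N + 1) → (Fin 3 → ℤ)) := fun v =>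
    {c | (fun k => (c k, v k)) ∈ T} with hTvdef
  have hTv : ∀ v, MeasurableSet (Tv v) := fun v =>
    (measurable_pi_lambda _ fun k => (measurable_pi_apply k).prodMk measurable_const) hT
  -- the two events and their measurability
  set E₁ : Set (Config (N + 1) (Fin 3) T3) := F ∩ {z | (gPair z, ωPair z) ∈ S} ∩ D with hE₁def
  set E₂ : Set (Config (N + 1) (Fin 3) T3) := F ∩ D with hE₂def
  have hFm : MeasurableSet F := measurableSet_firstFlightPairEvent Φ i j w
  have hAm : MeasurableSet (Φ.good ∩ {z | (gPair z, ωPair z) ∈ S}) := measurableSet_good_inter_pairObs Φ i j hS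
  have hDm : MeasurableSet D := (measurable_coarseConfig (Torus.measurable_coarseCell _)) hT
  have hE₁ : MeasurableSet E₁ := by
    have : E₁ = F ∩ (Φ.good ∩ {z | (gPair z, ωPair z) ∈ S}) ∩ D := by
      ext z
      simp only [hE₁def, mem_inter_iff]
      constructor
      · rintro ⟨⟨hF, hA⟩, hD⟩; exact ⟨⟨hF, hF.1, hA⟩, hD⟩
      · rintro ⟨⟨hF, -, hA⟩, hD⟩; exact ⟨⟨hF, hA⟩, hD⟩
    rw [this]
    exact (hFm.inter hAm).inter hDm
  have hE₂ : MeasurableSet E₂ := hFm.inter hDm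
  -- the sections along a frozen velocity configuration
  set m₁ : (Fin (N + 1) → V3) → ℝ≥0∞ := fun v => μ ((fun x => (x, v)) ⁻¹' (zipConfig ⁻¹' E₁)) with hm₁def
  set m₂ : (Fin (N + 1) → V3) → ℝ≥0∞ := fun v => μ ((fun x => (x, v)) ⁻¹' (zipConfig ⁻¹' E₂)) with hm₂def
  have hm₁ : Measurable m₁ := measurable_measure_prodMk_right (measurable_zipConfig hE₁)
  have hm₂ : Measurable m₂ := measurable_measure_prodMk_right (measurable_zipConfig hE₂)
  have hm₁le : ∀ v, (m₁ v).toReal ≤ 1 := fun v => by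
    have := ENNReal.toReal_mono ENNReal.one_ne_top (prob_le_one (μ := μ)
      (s := (fun x => (x, v)) ⁻¹' (zipConfig ⁻¹' E₁)))
    rwa [ENNReal.toReal_one] at this
  have hm₂le : ∀ v, (m₂ v).toReal ≤ 1 := fun v => by
    have := ENNReal.toReal_mono ENNReal.one_ne_top (prob_le_one (μ := μ)
      (s := (fun x => (x, v)) ⁻¹' (zipConfig ⁻¹' E₂)))
    rwa [ENNReal.toReal_one] at this
  -- along a fibre the pair quantities are functions of `v` (direction) and of `(x, v)` (normal)
  have hgz : ∀ x v, gPair (zipConfig (x, v)) = gV v := by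
    intro x v
    show ‖(zipConfig (x, v) i).2 - (zipConfig (x, v) j).2‖⁻¹ • ((zipConfig (x, v) i).2 - (zipConfig (x, v) j).2) =
      ‖v i - v j‖⁻¹ • (v i - v j)
    simp only [zipConfig_apply]
  have hcz : ∀ (x : Fin (N + 1) → T3) (v : Fin (N + 1) → V3),
      coarseConfig q (zipConfig (x, v)) = fun k => (q (x k), v k) := by
    intro x v
    funext k
    simp only [coarseConfig_apply, zipConfig_apply]
  have hsec₁ : ∀ v, (fun x => (x, v)) ⁻¹' (zipConfig ⁻¹' E₁) =
      {x | zipConfig (x, v) ∈ F ∧ ωPair (zipConfig (x, v)) ∈ Uv v ∧ (fun k => q (x k)) ∈ Tv v} := by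
    intro v
    ext x
    show zipConfig (x, v) ∈ E₁ ↔ zipConfig (x, v) ∈ F ∧ ωPair (zipConfig (x, v)) ∈ Uv v ∧ (fun k => q (x k)) ∈ Tv v
    constructor
    · rintro ⟨⟨hF, hA⟩, hD⟩
      have hA' : (gPair (zipConfig (x, v)), ωPair (zipConfig (x, v))) ∈ S := hA
      have hD' : coarseConfig q (zipConfig (x, v)) ∈ T := hD
      refine ⟨hF, ?_, ?_⟩
      · show (gV v, ωPair (zipConfig (x, v))) ∈ S
        rw [← hgz x v]; exact hA'
      · show (fun k => (q (x k), v k)) ∈ T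
        rw [← hcz x v]; exact hD'
    · rintro ⟨hF, hU, hT'⟩
      have hU' : (gV v, ωPair (zipConfig (x, v))) ∈ S := hU
      have hT'' : (fun k => (q (x k), v k)) ∈ T := hT'
      refine ⟨⟨hF, ?_⟩, ?_⟩
      · show (gPair (zipConfig (x, v)), ωPair (zipConfig (x, v))) ∈ S
        rw [hgz x v]; exact hU'
      · show coarseConfig q (zipConfig (x, v)) ∈ T
        rw [hcz x v]; exact hT''
  have hsec₂ : ∀ v, (fun x => (x, v)) ⁻¹' (zipConfig ⁻¹' E₂) =
      {x | zipConfig (x, v) ∈ F ∧ (fun k => q (x k)) ∈ Tv v} := by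
    intro v
    ext x
    show zipConfig (x, v) ∈ E₂ ↔ zipConfig (x, v) ∈ F ∧ (fun k => q (x k)) ∈ Tv v
    constructor
    · rintro ⟨hF, hD⟩
      have hD' : coarseConfig q (zipConfig (x, v)) ∈ T := hD
      refine ⟨hF, ?_⟩
      show (fun k => (q (x k), v k)) ∈ T
      rw [← hcz x v]; exact hD'
    · rintro ⟨hF, hT'⟩
      have hT'' : (fun k => (q (x k), v k)) ∈ T := hT'
      refine ⟨hF, ?_⟩
      show coarseConfig q (zipConfig (x, v)) ∈ T
      rw [hcz x v]; exact hT''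
  -- the pointwise bound on each fibre, from the input
  have hpt : ∀ v, |(m₁ v).toReal - flux (gV v) (Uv v) * (m₂ v).toReal| ≤ b v := by
    intro v
    have key := hbv v (Uv v) (hUv v) (Tv v) (hTv v)
    have e1 : m₁ v = μ {x | zipConfig (x, v) ∈ F ∧ ωPair (zipConfig (x, v)) ∈ Uv v ∧ (fun k => q (x k)) ∈ Tv v} := by
      show μ ((fun x => (x, v)) ⁻¹' (zipConfig ⁻¹' E₁)) = _
      rw [hsec₁ v]
    have e2 : m₂ v = μ {x | zipConfig (x, v) ∈ F ∧ (fun k => q (x k)) ∈ Tv v} := by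
      show μ ((fun x => (x, v)) ⁻¹' (zipConfig ⁻¹' E₂)) = _
      rw [hsec₂ v]
    rw [e1, e2]
    exact key
  -- the first term as an integral over the velocities
  have hP1 : (P E₁).toReal = ∫ v, (m₁ v).toReal ∂γ := by
    rw [hPeq, Measure.map_apply measurable_zipConfig hE₁, Measure.prod_apply_symm (measurable_zipConfig hE₁),
      integral_toReal hm₁.aemeasurable (ae_of_all _ fun v => measure_lt_top _ _)]
  -- the compensator as an integral over the velocities
  have hf : Measurable fun z : Config (N + 1) (Fin 3) T3 => flux (gPair z) {ω | (gPair z, ω) ∈ S} :=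
    (measurable_fluxFn hS).comp (measurable_pairDir i j)
  have hfz : ∀ x v, flux (gPair (zipConfig (x, v))) {ω | (gPair (zipConfig (x, v)), ω) ∈ S} = flux (gV v) (Uv v) := by
    intro x v
    rw [hgz x v]
  have hind : ∀ v, (fun x => E₂.indicator (fun z => flux (gPair z) {ω | (gPair z, ω) ∈ S}) (zipConfig (x, v))) =
      ((fun x => (x, v)) ⁻¹' (zipConfig ⁻¹' E₂)).indicator (fun _ => flux (gV v) (Uv v)) := by
    intro v
    funext x
    by_cases hx : zipConfig (x, v) ∈ E₂
    · rw [Set.indicator_of_mem hx, Set.indicator_of_mem (show x ∈ (fun x => (x, v)) ⁻¹' (zipConfig ⁻¹' E₂) from hx),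
        hfz x v]
    · rw [Set.indicator_of_notMem hx,
        Set.indicator_of_notMem (show x ∉ (fun x => (x, v)) ⁻¹' (zipConfig ⁻¹' E₂) from hx)]
  have hbound_ind : ∀ pv : (Fin (N + 1) → T3) × (Fin (N + 1) → V3),
      ‖E₂.indicator (fun z => flux (gPair z) {ω | (gPair z, ω) ∈ S}) (zipConfig pv)‖ ≤ 1 := by
    intro pv
    rw [Real.norm_eq_abs]
    by_cases hx : zipConfig pv ∈ E₂
    · rw [Set.indicator_of_mem hx]
      have hz := fluxFn_mem_Icc (gPair (zipConfig pv)) {ω | (gPair (zipConfig pv), ω) ∈ S}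
      rw [abs_of_nonneg hz.1]
      exact hz.2
    · rw [Set.indicator_of_notMem hx, abs_zero]
      exact zero_le_one
  have hint_prod : Integrable (fun pv => E₂.indicator (fun z => flux (gPair z) {ω | (gPair z, ω) ∈ S}) (zipConfig pv))
      (μ.prod γ) :=
    Integrable.of_bound (((hf.indicator hE₂).comp measurable_zipConfig).aestronglyMeasurable) 1
      (ae_of_all _ hbound_ind)
  have hI : ∫ z in E₂, flux (gPair z) {ω | (gPair z, ω) ∈ S} ∂P = ∫ v, flux (gV v) (Uv v) * (m₂ v).toReal ∂γ := by
    rw [← integral_indicator hE₂, hPeq,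
      integral_map measurable_zipConfig.aemeasurable (hf.indicator hE₂).aestronglyMeasurable,
      integral_prod_symm _ hint_prod]
    refine integral_congr_ae (ae_of_all _ fun v => ?_)
    show ∫ x, E₂.indicator (fun z => flux (gPair z) {ω | (gPair z, ω) ∈ S}) (zipConfig (x, v)) ∂μ = _
    rw [hind v, integral_indicator_const _ (measurable_prodMk_right (measurable_zipConfig hE₂)), smul_eq_mul,
      measureReal_def, mul_comm]
  -- integrability on the velocity side
  have hg : Measurable fun v => flux (gV v) (Uv v) := (measurable_fluxFn hS).comp hgVm
  have hint₁ : Integrable (fun v => (m₁ v).toReal) γ :=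
    Integrable.of_bound hm₁.ennreal_toReal.aestronglyMeasurable 1
      (ae_of_all _ fun v => by rw [Real.norm_eq_abs, abs_of_nonneg ENNReal.toReal_nonneg]; exact hm₁le v)
  have hint₂ : Integrable (fun v => flux (gV v) (Uv v) * (m₂ v).toReal) γ := by
    refine Integrable.of_bound (hg.mul hm₂.ennreal_toReal).aestronglyMeasurable 1 (ae_of_all _ fun v => ?_)
    have hz := fluxFn_mem_Icc (gV v) (Uv v)
    rw [Real.norm_eq_abs, abs_of_nonneg (mul_nonneg hz.1 ENNReal.toReal_nonneg)]
    calc flux (gV v) (Uv v) * (m₂ v).toReal ≤ 1 * 1 :=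
        mul_le_mul hz.2 (hm₂le v) ENNReal.toReal_nonneg zero_le_one
      _ = 1 := one_mul 1
  -- conclude
  show |(P E₁).toReal - ∫ z in E₂, flux (gPair z) {ω | (gPair z, ω) ∈ S} ∂P| ≤ C * σ ^ p / (N + 1)
  rw [hP1, hI, ← integral_sub hint₁ hint₂]
  calc |∫ v, ((m₁ v).toReal - flux (gV v) (Uv v) * (m₂ v).toReal) ∂γ|
      ≤ ∫ v, |(m₁ v).toReal - flux (gV v) (Uv v) * (m₂ v).toReal| ∂γ := abs_integral_le_integral_abs
    _ ≤ ∫ v, b v ∂γ := integral_mono (hint₁.sub hint₂).abs hbi fun v => hpt v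
    _ ≤ C * σ ^ p / (N + 1) := hbint

/-- **The reduction of the first rung to the velocity-fibre input**: `FirstFlightVelInput θ₀` implies the flux-form
body of the crux on the regime `{s_i = s_j} ∩ {n = 0}` (the lead's `(shortGap θ₀ 0).inter nZero`). [folklore] -/
theorem regimeFluxBody_firstFlight_of_velInput : ∀ {θ₀ : ℝ}, 0 < θ₀ → Summit.AtomisticToContinuum.HydrodynamicLimit.Theorems.OLC.FirstFlightVelInput θ₀ → Summit.AtomisticToContinuum.HydrodynamicLimit.Theorems.OLC.RegimeFluxBody θ₀ ((Summit.AtomisticToContinuum.HydrodynamicLimit.Theorems.OLC.shortGap θ₀ 0).inter (fun _ n _ _ _ => {_z | n = 0})) := by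
  intro θ₀ hθ h
  exact regimeFluxBody_firstFlight_of_pairInput hθ (firstFlightPairInput_of_velInput hθ h)

end

end Summit.AtomisticToContinuum.HydrodynamicLimit.Theorems.OLC
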